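import Mathlib
import Summits.QuantumFields.YangMills.Theorems.BalabanUVNodesN15CoefficientSpeciesTorus
import Summits.QuantumFields.YangMills.Theorems.BalabanUVNodesN15FirstOrderDefect
import HarnessLib

/-!
# Route «BalabanUVNodes» (cluster K4 «SpineRates»), Track-A DAG node N15 = spine estimate NE2, BACKGROUND LAYER — FIRST MISSING
# ESTIMATE, part 12e: THE SANDWICHED PERTURBATION DEFECTS OF g0's FILE 4 WITH THE COEFFICIENT-FIT BINDER `hfit` DISCHARGED — on King's
# torus carrier, the zeroth-order terms (coefficient = the field ∕ its transporter map `phi1` ∕ `F′_{1,k} = phi2` ∕ its divergence) and the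
# first-order term of `V′₁(A)` have source-weighted majorants from (3.35)∕(3.36)-SHAPED REGULARITY LETTERS of the fine background alone

Cell `pub-ymgap`, seat `pub-ymgap-dag-n15-b` (generation g2; FIRST-MISSING-ESTIMATE, HUMAN RULING D-0062; chair R424 venue; ROSTER-D0062 l.26).
`bears_on: R4∕N15`.  Filed `--supports stmt-QuantumFields-19351`.  COMPOSITION BY NAME of g0's file 4 `…N15FirstOrderDefect` (p410747 ✓:
`hasMaj_comp_idef_zerothOrder_comp`, `hasMaj_comp_idef_firstOrder_comp`) with this generation's parts 12a–12d (`fit_blockMeanT`, `fit_phi1_blockMeanT`,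
`fit_phi2_blockMeanT`, `fit_bdiffN_blockMeanT`) at the line data `kingLine L M μ` of g0's `…N15KingTorusLine` (p412650 ✓; `π = blockOf L M`, spacing ratio
`L`).  Nothing landed is modified; 0 `def`.

WHAT THIS CLOSES (the binder map of `idef_background_propagator_majorant`, memo `HOME/pub-ymgap-dag-n15-b/N15B-BACKGROUND-LAYER.md` §2b, row (d)):
the SANDWICHED perturbation defect `G₁′ ∘ 𝔇(V′,V) ∘ X` (binder `hDV`) was PRODUCED by file 4 from (d1) `∇X ≤ A₁e^{−(ρ+σ)d}` ((3.42)₂ coarse), (d2) the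
adjoint-derivative entry of the fine left factor ((3.42)₃ + (3.35) letters, file 11), (d4) `|η′|(M−1) ≤ c_η w`, and (d3) THE COEFFICIENT FIT `hfit : ∀ x′,
|a′ x′ − a (π x′)| ≤ o (blk (π x′))` — a hypothesis on the PAIR (fine coefficient, coarse coefficient).  Under the linearised background transport (coarse
coefficient := the block mean of the fine one, resp. its `phi1`∕`phi2` image ∕ its coarse difference quotient) (d3) is now a THEOREM from located
regularity letters on the FINE background of the printed shapes — [Balaban1985BackgroundPropagators] (3.35) p. 396 *«|A| < O(1)Mα₀(L^jη)^{−1},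
|∇^ηA| < O(1)Mα₀(L^jη)^{−2} on □»* (the in-block bond letter `θ₁`, the sup letter `r`) and (3.36) p. 396 *«|∂^{η*}∂^ηA| < O(1)Mα₀(L^jη)^{−3}»* (the slab
letter `θ₂` on the fine derivative) — plus ONE domination inequality placing the fit under the consumer's weight (`… ≤ ε·w(blk b)`; for the η-rate weight
this is the arithmetic of `fit_blockMean_rate` ∕ `species1_rate` ∕ `species2_rate`: every species ONE rate factor `η∕ℓ`).  So after this file the
background step's inputs are: (a) NE2⁰ (the -a seat), the one-run letters (b) (c) (d1) (d2) of printed shape (in-edge N06's currency), the fine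
background's (3.35)∕(3.36)-shaped letters, and geometry — no coefficient-pair hypothesis.

CONTENTS ([folklore] composition; every theorem is ONE application of a file-4 theorem with `hfit` supplied by a 12d fit + a domination).
* `zerothOrder_field` — `T′ ∘ 𝔇(M_{a′}, M_{blockMeanT a′}) ∘ A ≤ m_T(ε₀A₀C)e^{−ρd}w` from the in-block bond letter `θ₁` and `d(L−1)θ₁(b) ≤ ε₀w(blk b)`.
* `zerothOrder_phi1`, `zerothOrder_phi2` — the same for the transporter coefficient `phi1(η′, a′)` vs `phi1(η, blockMeanT a′)` and for `F′_{1,k}` (`phi2`),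
  letters `|a′| ≤ r`, `θ₁`, regime `0 ≤ η′ ≤ η ≤ η₀`, `η₀r ≤ 1`, domination of `K·d(L−1)θ₁(b) + 2K′η`.
* `zerothOrder_divergence` — the same for the divergence coefficient `∇^{η′*}_ν a′` vs `∇^{η*}_ν(blockMeanT a′)` (`Lη′ = η`), slab letter `θ₂` on the fine
  derivative, domination of `(d+1)(L−1)θ₂(b − e_ν)`.
* `firstOrder_field` — file 4's `hasMaj_comp_idef_firstOrder_comp` at `D := kingLine L M μ` (fine coefficient `a′`, coarse `blockMeanT a′`) with `hfit` from `θ₁`: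
  majorant `(m₃A₁c_η + m_T(εA₁C))·e^{−ρd}·w(y′)`.

HONEST FRAMING ∕ LIMITS.  MECHANISM: block norms, geometry, the factors `T′`, `A` and their (3.42)-SHAPED majorants, the weight and its slowness remain binders
(displayed); real scalar coefficients; LINEARISED transport (Bałaban's nonlinear (C3) average: its fit letter is NE3's currency); King's torus carrier; no instance
against [B6]∕[B9]'s expansions.  NE2⁺ NOT PRINTED, NOT proved; count-neutral (typed 28∕28; nothing discharged); finite tori at fixed ε — NOT infinite volume,
NOT OS on ℝ⁴, NOT a mass gap, NOT Clay.
-/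

noncomputable section

namespace Summit.QuantumFields.YangMills.BalabanUVNodes.N15.CoefficientSpecies

open Literature.MathematicalPhysics.QuantumFieldTheory.Balaban1983to89
open Literature.MathematicalPhysics.QuantumFieldTheory.Balaban1983to89.B11SectG (BlockNorm HasMaj)
open Literature.MathematicalPhysics.QuantumFieldTheory.Balaban1983to89.T4EtaRateDefect (idef SlowWeight)
open Literature.MathematicalPhysics.QuantumFieldTheory.Balaban1983to89.T4EtaRateCoeffDefect (pull)
open Literature.MathematicalPhysics.QuantumFieldTheory.Balaban1983to89.B9SectDWeightedNeumann (WRow)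
open Literature.MathematicalPhysics.QuantumFieldTheory.Balaban1983to89.B6RandomWalk (Triangle254)
open Literature.MathematicalPhysics.QuantumFieldTheory.Balaban1983to89.B6Prop26Gluing (mulOp)
open Literature.MathematicalPhysics.QuantumFieldTheory.Balaban1983to89.B5Prop11Plancherel (Tor fine)
open Literature.MathematicalPhysics.QuantumFieldTheory.King1986.Torus (blockOf)
open Summit.QuantumFields.YangMills.BalabanUVNodes.N15.DerivDefect (fdiffN bdiffN hasMaj_comp_idef_zerothOrder_comp
  hasMaj_comp_idef_firstOrder_comp)
open Summit.QuantumFields.YangMills.BalabanUVNodes.N15.KingTorusLine (unitVec kingLine)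

variable {d : ℕ} (L : ℕ) [NeZero L] (M : Fin d → ℕ) [hM : ∀ μ, NeZero (M μ)]
variable {g : B6.Geometry} (blk : Tor M → g.Site)
variable {F₁ F₃ : Type} [AddCommGroup F₁] [Module ℝ F₁] [AddCommGroup F₃] [Module ℝ F₃] {b₁ : BlockNorm g F₁} {b₃ : BlockNorm g F₃}

/-! ## §1 Zeroth-order terms -/

/-- ZEROTH-ORDER TERM, COEFFICIENT = THE FIELD (`c′ = a′`, `c = blockMeanT a′`): the sandwiched defect `T′ ∘ 𝔇(M_{a′}, M_{blockMeanT a′}) ∘ A` has the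
source-weighted majorant `m_T(ε₀A₀C)·e^{−ρd}·w(y′)` from the (3.35)-SHAPED in-block bond letter `θ₁ ≥ 0` on the fine field and the domination
`d(L−1)θ₁(b) ≤ ε₀·w(blk b)` (file 4 `hasMaj_comp_idef_zerothOrder_comp` + 12d `fit_blockMeanT`). [folklore] -/
theorem zerothOrder_field (htri : Triangle254 g) (hdiag : ∀ y, g.dist y y = 0) {ρ σ C ε₀ A₀ m_T : ℝ}
    (hρ : 0 ≤ ρ) (hA₀ : 0 ≤ A₀) (hC : 0 ≤ C) (hε₀ : 0 ≤ ε₀) {w : g.Site → ℝ} (hw : ∀ y, 0 ≤ w y) (hsw : SlowWeight g σ C w)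
    {a' : Tor (fine L M) → ℝ} {θ₁ : Tor M → ℝ} (hθ : ∀ b, 0 ≤ θ₁ b)
    (hbond : ∀ (y' : Tor (fine L M)) (ν : Fin d), blockOf L M (y' + unitVec (fine L M) ν) = blockOf L M y' →
      |a' (y' + unitVec (fine L M) ν) - a' y'| ≤ θ₁ (blockOf L M y'))
    (hdom : ∀ b, (d : ℝ) * ((L : ℝ) - 1) * θ₁ b ≤ ε₀ * w (blk b))
    {T' : (Tor (fine L M) → ℝ) →ₗ[ℝ] F₃} {A : F₁ →ₗ[ℝ] (Tor M → ℝ)} {N_T : g.Site → g.Site → ℝ} (hNT : ∀ a b, 0 ≤ N_T a b)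
    (hmT : WRow g ρ N_T m_T) (hT : HasMaj (BlockNorm.ofBlocks g (blk ∘ blockOf L M)) b₃ T' N_T)
    (hA : HasMaj b₁ (BlockNorm.ofBlocks g blk) A (fun y y' => A₀ * Real.exp (-((ρ + σ) * g.dist y y')))) :
    HasMaj b₁ b₃ (T' ∘ₗ idef (pull (blockOf L M)) (pull (blockOf L M)) (mulOp a') (mulOp (blockMeanT L M a')) ∘ₗ A)
      (fun y y' => m_T * (ε₀ * A₀ * C) * Real.exp (-(ρ * g.dist y y')) * w y') :=
  hasMaj_comp_idef_zerothOrder_comp blk (blockOf L M) htri hdiag hρ hA₀ hC hε₀ hw hsw (o₀ := fun s => ε₀ * w s)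
    (fun s => mul_nonneg hε₀ (hw s)) (fun _ => le_rfl)
    (fun y' => (fit_blockMeanT L M hθ hbond y').trans (hdom _)) hNT hmT hT hA

/-- ZEROTH-ORDER TERM, COEFFICIENT = THE TRANSPORTER MAP `phi1(η′, a′)` vs `phi1(η, blockMeanT a′)` ((3.50)'s `η⁻¹(e^{iη ad A} − 1)`, real scalar model): letters
`|a′| ≤ r`, `θ₁`, regime `0 ≤ η′ ≤ η ≤ η₀`, `η₀r ≤ 1`, domination `e·d(L−1)θ₁(b) + 2r²η ≤ ε₀·w(blk b)` (12d `fit_phi1_blockMeanT`). [folklore] -/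
theorem zerothOrder_phi1 (htri : Triangle254 g) (hdiag : ∀ y, g.dist y y = 0) {ρ σ C ε₀ A₀ m_T η₀ r η η' : ℝ}
    (hρ : 0 ≤ ρ) (hA₀ : 0 ≤ A₀) (hC : 0 ≤ C) (hε₀ : 0 ≤ ε₀) {w : g.Site → ℝ} (hw : ∀ y, 0 ≤ w y) (hsw : SlowWeight g σ C w)
    (hreg : η₀ * r ≤ 1) (hη' : 0 ≤ η') (hη'η : η' ≤ η) (hη : η ≤ η₀)
    {a' : Tor (fine L M) → ℝ} (ha' : ∀ y', |a' y'| ≤ r) {θ₁ : Tor M → ℝ} (hθ : ∀ b, 0 ≤ θ₁ b)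
    (hbond : ∀ (y' : Tor (fine L M)) (ν : Fin d), blockOf L M (y' + unitVec (fine L M) ν) = blockOf L M y' →
      |a' (y' + unitVec (fine L M) ν) - a' y'| ≤ θ₁ (blockOf L M y'))
    (hdom : ∀ b, Real.exp 1 * ((d : ℝ) * ((L : ℝ) - 1) * θ₁ b) + 2 * r ^ 2 * η ≤ ε₀ * w (blk b))
    {T' : (Tor (fine L M) → ℝ) →ₗ[ℝ] F₃} {A : F₁ →ₗ[ℝ] (Tor M → ℝ)} {N_T : g.Site → g.Site → ℝ} (hNT : ∀ a b, 0 ≤ N_T a b)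
    (hmT : WRow g ρ N_T m_T) (hT : HasMaj (BlockNorm.ofBlocks g (blk ∘ blockOf L M)) b₃ T' N_T)
    (hA : HasMaj b₁ (BlockNorm.ofBlocks g blk) A (fun y y' => A₀ * Real.exp (-((ρ + σ) * g.dist y y')))) :
    HasMaj b₁ b₃ (T' ∘ₗ idef (pull (blockOf L M)) (pull (blockOf L M)) (mulOp fun y' => phi1 η' (a' y'))
        (mulOp fun b => phi1 η (blockMeanT L M a' b)) ∘ₗ A)
      (fun y y' => m_T * (ε₀ * A₀ * C) * Real.exp (-(ρ * g.dist y y')) * w y') :=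
  hasMaj_comp_idef_zerothOrder_comp blk (blockOf L M) htri hdiag hρ hA₀ hC hε₀ hw hsw (o₀ := fun s => ε₀ * w s)
    (fun s => mul_nonneg hε₀ (hw s)) (fun _ => le_rfl)
    (fun y' => (fit_phi1_blockMeanT L M hreg hη' hη'η hη ha' hθ hbond y').trans (hdom _)) hNT hmT hT hA

/-- ZEROTH-ORDER TERM, COEFFICIENT = `F′_{1,k}` (`phi2(η′, a′)` vs `phi2(η, blockMeanT a′)`, (3.51)–(3.52), real scalar model): the same with domination
`2r·d(L−1)θ₁(b) + 2r³η ≤ ε₀·w(blk b)` (12d `fit_phi2_blockMeanT`). [folklore] -/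
theorem zerothOrder_phi2 (htri : Triangle254 g) (hdiag : ∀ y, g.dist y y = 0) {ρ σ C ε₀ A₀ m_T η₀ r η η' : ℝ}
    (hρ : 0 ≤ ρ) (hA₀ : 0 ≤ A₀) (hC : 0 ≤ C) (hε₀ : 0 ≤ ε₀) {w : g.Site → ℝ} (hw : ∀ y, 0 ≤ w y) (hsw : SlowWeight g σ C w)
    (hreg : η₀ * r ≤ 1) (hr : 0 ≤ r) (hη' : 0 ≤ η') (hη'η : η' ≤ η) (hη : η ≤ η₀)
    {a' : Tor (fine L M) → ℝ} (ha' : ∀ y', |a' y'| ≤ r) {θ₁ : Tor M → ℝ} (hθ : ∀ b, 0 ≤ θ₁ b)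
    (hbond : ∀ (y' : Tor (fine L M)) (ν : Fin d), blockOf L M (y' + unitVec (fine L M) ν) = blockOf L M y' →
      |a' (y' + unitVec (fine L M) ν) - a' y'| ≤ θ₁ (blockOf L M y'))
    (hdom : ∀ b, 2 * r * ((d : ℝ) * ((L : ℝ) - 1) * θ₁ b) + 2 * r ^ 3 * η ≤ ε₀ * w (blk b))
    {T' : (Tor (fine L M) → ℝ) →ₗ[ℝ] F₃} {A : F₁ →ₗ[ℝ] (Tor M → ℝ)} {N_T : g.Site → g.Site → ℝ} (hNT : ∀ a b, 0 ≤ N_T a b)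
    (hmT : WRow g ρ N_T m_T) (hT : HasMaj (BlockNorm.ofBlocks g (blk ∘ blockOf L M)) b₃ T' N_T)
    (hA : HasMaj b₁ (BlockNorm.ofBlocks g blk) A (fun y y' => A₀ * Real.exp (-((ρ + σ) * g.dist y y')))) :
    HasMaj b₁ b₃ (T' ∘ₗ idef (pull (blockOf L M)) (pull (blockOf L M)) (mulOp fun y' => phi2 η' (a' y'))
        (mulOp fun b => phi2 η (blockMeanT L M a' b)) ∘ₗ A)
      (fun y y' => m_T * (ε₀ * A₀ * C) * Real.exp (-(ρ * g.dist y y')) * w y') :=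
  hasMaj_comp_idef_zerothOrder_comp blk (blockOf L M) htri hdiag hρ hA₀ hC hε₀ hw hsw (o₀ := fun s => ε₀ * w s)
    (fun s => mul_nonneg hε₀ (hw s)) (fun _ => le_rfl)
    (fun y' => (fit_phi2_blockMeanT L M hreg hr hη' hη'η hη ha' hθ hbond y').trans (hdom _)) hNT hmT hT hA

/-- ZEROTH-ORDER TERM, COEFFICIENT = THE DIVERGENCE's SUMMAND `∇^{η′*}_ν a′` vs `∇^{η*}_ν (blockMeanT a′)` ((3.52)'s `(D^{η*}_U A)(x)`; `Lη′ = η`): the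
(3.36)-SHAPED slab letter `θ₂` on the fine derivative `∇^{η′}_ν a′` and the domination `(d+1)(L−1)θ₂(b − e_ν) ≤ ε₀·w(blk b)` (12d `fit_bdiffN_blockMeanT`).
[folklore] -/
theorem zerothOrder_divergence (ν : Fin d) (htri : Triangle254 g) (hdiag : ∀ y, g.dist y y = 0) {ρ σ C ε₀ A₀ m_T η η' : ℝ}
    (hLη : (L : ℝ) * η' = η) (hρ : 0 ≤ ρ) (hA₀ : 0 ≤ A₀) (hC : 0 ≤ C) (hε₀ : 0 ≤ ε₀) {w : g.Site → ℝ} (hw : ∀ y, 0 ≤ w y)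
    (hsw : SlowWeight g σ C w) {a' : Tor (fine L M) → ℝ} {θ₂ : Tor M → ℝ}
    (hslab : ∀ (b : Tor M) (z' : Tor (fine L M)), (blockOf L M z' = b ∨ blockOf L M z' = b + unitVec M ν) → ∀ κ : Fin d,
      |fdiffN η' (fun y => y + unitVec (fine L M) ν) a' (z' + unitVec (fine L M) κ) -
        fdiffN η' (fun y => y + unitVec (fine L M) ν) a' z'| ≤ θ₂ b)
    (hdom : ∀ b, ((d : ℝ) + 1) * ((L : ℝ) - 1) * θ₂ (b - unitVec M ν) ≤ ε₀ * w (blk b))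
    {T' : (Tor (fine L M) → ℝ) →ₗ[ℝ] F₃} {A : F₁ →ₗ[ℝ] (Tor M → ℝ)} {N_T : g.Site → g.Site → ℝ} (hNT : ∀ a b, 0 ≤ N_T a b)
    (hmT : WRow g ρ N_T m_T) (hT : HasMaj (BlockNorm.ofBlocks g (blk ∘ blockOf L M)) b₃ T' N_T)
    (hA : HasMaj b₁ (BlockNorm.ofBlocks g blk) A (fun y y' => A₀ * Real.exp (-((ρ + σ) * g.dist y y')))) :
    HasMaj b₁ b₃ (T' ∘ₗ idef (pull (blockOf L M)) (pull (blockOf L M))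
        (mulOp (bdiffN η' (Equiv.addRight (unitVec (fine L M) ν)) a'))
        (mulOp (bdiffN η (Equiv.addRight (unitVec M ν)) (blockMeanT L M a'))) ∘ₗ A)
      (fun y y' => m_T * (ε₀ * A₀ * C) * Real.exp (-(ρ * g.dist y y')) * w y') :=
  hasMaj_comp_idef_zerothOrder_comp blk (blockOf L M) htri hdiag hρ hA₀ hC hε₀ hw hsw (o₀ := fun s => ε₀ * w s)
    (fun s => mul_nonneg hε₀ (hw s)) (fun _ => le_rfl)
    (fun y' => (fit_bdiffN_blockMeanT L M ν hLη hslab y').trans (hdom _)) hNT hmT hT hA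

/-! ## §2 The first-order term -/

/-- FIRST-ORDER TERM `M_{a′}∇′_{η′}` vs `M_{blockMeanT a′}∇_η` ON KING's CARRIER (`D := kingLine L M μ`, `Lη′ = η`): file 4's
`hasMaj_comp_idef_firstOrder_comp` with the coefficient fit SUPPLIED by the (3.35)-SHAPED in-block bond letter `θ₁` and the domination
`d(L−1)θ₁(b) ≤ ε·w(blk b)`; the other binders — (d1) `∇_η ∘ A ≤ A₁e^{−(ρ+σ)d}`, (d2) the adjoint-derivative entry `N₃` of `T′ ∘ M_{a′}`, (d4)
`|η′|(L−1) ≤ c_η w`, the left factor `T′ ≤ N_T`, slow weight — verbatim.  Majorant `(m₃A₁c_η + m_T(εA₁C))·e^{−ρd}·w(y′)`. [folklore] -/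
theorem firstOrder_field (μ : Fin d) {η η' : ℝ} (hη' : η' ≠ 0) (hLη : (L : ℝ) * η' = η) (htri : Triangle254 g)
    (hd : ∀ a b : g.Site, 0 ≤ g.dist a b) (hdiag : ∀ y, g.dist y y = 0) {ρ σ C ε A₁ m_T m₃ cη : ℝ} (hρ : 0 ≤ ρ)
    (hσ : 0 ≤ σ) (hA₁ : 0 ≤ A₁) (hC : 0 ≤ C) (hε : 0 ≤ ε) {w : g.Site → ℝ} (hw : ∀ y, 0 ≤ w y) (hsw : SlowWeight g σ C w)
    (hηw : ∀ y', |η'| * ((L : ℝ) - 1) ≤ cη * w y')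
    {a' : Tor (fine L M) → ℝ} {θ₁ : Tor M → ℝ} (hθ : ∀ b, 0 ≤ θ₁ b)
    (hbond : ∀ (y' : Tor (fine L M)) (ν : Fin d), blockOf L M (y' + unitVec (fine L M) ν) = blockOf L M y' →
      |a' (y' + unitVec (fine L M) ν) - a' y'| ≤ θ₁ (blockOf L M y'))
    (hdom : ∀ b, (d : ℝ) * ((L : ℝ) - 1) * θ₁ b ≤ ε * w (blk b))
    {T' : (Tor (fine L M) → ℝ) →ₗ[ℝ] F₃} {A : F₁ →ₗ[ℝ] (Tor M → ℝ)} {N_T N₃ : g.Site → g.Site → ℝ}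
    (hNT : ∀ a b, 0 ≤ N_T a b) (hmT : WRow g ρ N_T m_T)
    (hT : HasMaj (BlockNorm.ofBlocks g (blk ∘ (kingLine L M μ).π)) b₃ T' N_T)
    (hN₃ : ∀ a b, 0 ≤ N₃ a b) (hm₃ : WRow g ρ N₃ m₃)
    (hS : HasMaj (BlockNorm.ofBlocks g (blk ∘ (kingLine L M μ).π)) b₃ ((T' ∘ₗ mulOp a') ∘ₗ bdiffN η' (kingLine L M μ).s') N₃)
    (hA : HasMaj b₁ (BlockNorm.ofBlocks g blk) (fdiffN η (kingLine L M μ).s ∘ₗ A)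
      (fun y y' => A₁ * Real.exp (-((ρ + σ) * g.dist y y')))) :
    HasMaj b₁ b₃ (T' ∘ₗ idef (pull (kingLine L M μ).π) (pull (kingLine L M μ).π) (mulOp a' ∘ₗ fdiffN η' (kingLine L M μ).s')
        (mulOp (blockMeanT L M a') ∘ₗ fdiffN η (kingLine L M μ).s) ∘ₗ A)
      (fun y y' => (m₃ * A₁ * cη + m_T * (ε * A₁ * C)) * Real.exp (-(ρ * g.dist y y')) * w y') :=
  hasMaj_comp_idef_firstOrder_comp (kingLine L M μ) blk hη' hLη htri hd hdiag hρ hσ hA₁ hC hε hw hsw hηw (o := fun s => ε * w s)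
    (fun s => mul_nonneg hε (hw s)) (fun _ => le_rfl)
    (fun y' => (fit_blockMeanT L M hθ hbond y').trans (hdom _)) hNT hmT hT hN₃ hm₃ hS hA

end Summit.QuantumFields.YangMills.BalabanUVNodes.N15.CoefficientSpecies
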